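import Literature.MathematicalPhysics.QuantumFieldTheory.Balaban1983to89.B11Eq36Complex
import Literature.MathematicalPhysics.QuantumFieldTheory.Balaban1983to89.B11Eq90StB

/-!
# `Balaban1983to89.B11Eq90V0primeBond` — T. Bałaban, *The variational problem and background fields in renormalization group method for lattice gauge theories*, Commun. Math. Phys. **102** (1985) 277–309 [Balaban1985Variational]: (39) p. 284 and (63) p. 287 inside (90) p. 291 — `V′₀(A, ∂p)` AS A NAMED ENTIRE FUNCTION of the configuration, the ONE-BOND FUNCTIONAL `X ↦ ((∂/∂A(b))V′₀)(A, ∂p)·X` AS A CONTINUOUS LINEAR MAP (the Fréchet derivative (63) composed with the one-bond injection), its OPERATOR-NORM form of p. 291's sentence, its vanishing off `st(b)`, and the plaquette weight bookkeeping for the sizes `|·|_{(−n)}`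

statement-level skeleton of published theorems with citation tags; proofs where landed; nothing here is a claim about the Yang–Mills mass gap

PDF held: `paper:balaban1985-cmp102-variational-background` (journal page = PDF page + 276); pp. 282–284, 287, 291–293 read by this seat
from the `lit read` text layer; displays as transcribed (render-read) in `B11Eq26ActionExpansion` ((29)–(31)), `B11Eq37NormBound`
((39)–(40)), `B11Eq85FirstDerivative` ((90)), `B11Eq115Space` ((98), (115)).

CITATION HEADER (lean-in-tree rule 2026-08-18).  WHAT IS REPRODUCED: the V′₀-group of the termwise estimates of `(δ/δA′)V` (proof of
Proposition 4, row `B11.Eq85` of reader r08's `ROWS-B11.md`), ONE LEVEL ABOVE the line-derivative sentence certified in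
`B11Eq90V0Derivative` / `B11Eq36Complex`: there the quantity bounded is the number `(d/dt)V′₀(A + tδA, ∂p)|_{t=0}` for ONE direction
`δA`; here the same derivative is packaged as print's LINEAR OPERATOR on the bond variable ((63): *«The functional derivative is a
kernel of the linear operator acting on functions δA′ and defined as ⟨(δ/δA′)D(A′), δA′⟩ = (d/dτ)D(A′ + τδA′)|_{τ=0}»*), i.e. the
object `((∂/∂A(b))V′₀)(A, ∂p)` that (90) SUMS over `p ∈ st(b)`: *«(δ/δA′(b)) V′₀(A′ − HD(A′)) = Σ_{p∈st(b)} ((∂/∂A(b))V′₀)(A′ −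
HD(A′), ∂p) − … (90) where st(b) denotes a set of plaquettes p such that b ⊂ ∂p. The derivative ((∂/∂A(b))V′₀)(A, ∂p) satisfies a
bound similar to the bound (40) for the function V′₀(A, ∂p), but with the power of |A| lower by 1, and with a different absolute
constant.»* (p. 291), with (39) p. 284: *«V₀(A, ∂p) = ½ tr(DA)(p) Σ_{b₁≺b₂} i[A′(b₁), A′(b₂)] + V₀′(A, ∂p), (39) where V₀′(A, ∂p) is
defined by this equality»*, and p. 292 (Prop. 4): *«The functional derivative of V(A′) is an analytic function on this space»*.

WHY THIS FILE (cell context).  The pub-balaban NE9 letter (L3) `W = (δ/δA′)V : Space115 … → NegSize … 3 V` (INTERFACE REQUEST NE9,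
HOME/INBOX.md l.11394–11396; r08's slot `B11Prop4Assembly.TermwiseDatum.W₄` / `est90` / `an₄`; the `Regime.quad : QuadAnalytic W C₄ a₃`
slot of `B11Eq174Chart` AT THE CARRIER — PRICING-NE9 v20 §A request line) needs the V′₀-group as a CONFIGURATION-VALUED, Fréchet-
differentiable map with a quadratic size bound.  The companion `B11Eq90V0primeCurrent` builds that current on the (115) carriers of
`B11Eq115Space`; THIS file supplies its carrier-free ingredients on [5]'s abstract lattice of `B9Eq39Adjoint` (sites `S`, directions
`ι`, bijective shifts `T`, background units `U`): a NAME for `V′₀(A, ∂p)` (so far an inline expression in `B11Eq36Complex`), its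
`ContDiff ℂ n` regularity (the source of Fréchet differentiability of `A ↦ (∂V′₀/∂A)(A)`), the one-bond functional as a `→L[ℂ]`, and
the estimate of ITS OPERATOR NORM by p. 291's sentence.

WHAT IS DEFINED AND PROVED (sorry-free; axioms `propext` / `Classical.choice` / `Quot.sound`; defs are plumbing with bodies, no
`Prop`-valued definition, no new named fact).
§1 `term39 T U η τ A μ ν x` (= `½ i tr((DA)(p) Σ_{b₁≺b₂}[A′(b₁), A′(b₂)])`, the first member of (39), in the letters of
   `B11Eq36Complex.ineq40_first_complex`), **`V0primeP`** (= `V′₀(A, ∂p) := V₀(A, ∂p) − term39`, (39) «defined by this equality»);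
   `contDiff_expAlgebra`, `contDiff_R`, `contDiff_rem_four`, `contDiff_rem3`, **`contDiff_V0p`**, `contDiff_curlη`, `contDiff_term39`,
   **`contDiff_V0primeP`** — `V₀(A, ∂p)`, `V′₀(A, ∂p)` are `Cⁿ` for every `n : WithTop ℕ∞` (p. 282 «an analytic, and even an entire
   function of A»; `NormedSpace.exp_analytic` + `fun_prop`), hence `differentiable_fderiv_V0primeP` (the Fréchet derivative
   `A ↦ D(V′₀(·, ∂p))(A)` is itself differentiable — what «The functional derivative of V(A′) is an analytic function» needs termwise).
§2 `δL μ₀ x₀ : 𝔸 →L[ℂ] (ι → S → 𝔸)` (the one-bond injection; `δL_apply` = `B11Eq90StB.bondDelta`), `norm_R_le`,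
   `size_lettersA_bondDelta_le` (`|δ_b X|(∂p) ≦ 4‖X‖` for a background in the unit ball of `𝔸` and of `𝔸⁻¹`);
   **`dV0primeBond T U η τ A q μ₀ x₀ : 𝔸 →L[ℂ] ℂ`** = `X ↦ ((∂/∂A(b))V′₀)(A, ∂q)·X` ((63) composed with `δL`), `dV0primeBond_apply` (= the
   line derivative of `B11Eq36Complex.norm_deriv_V0prime_line_le`), `term39_add_smul_of_letters_zero`, `V0primeP_add_smul_of_letters_zero`,
   **`dV0primeBond_eq_zero_of_not_mem_st`** (a plaquette outside `st(b)` has zero one-bond functional — (90)'s «Σ_{p∈st(b)}»),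
   **`opNorm_dV0primeBond_le`** — p. 291's SENTENCE IN OPERATOR NORM: `‖(∂/∂A(b))V′₀(A, ∂q)‖ ≦ 4(8s²ηκ + (4/3)s³)` for `|A|(∂q) ≦ s`,
   `e^{2ηs} ≦ 2`, under the (38)/(31) trace-slot displays of `B11Eq36Complex` (radius `Δ = 4‖X‖` in `norm_deriv_V0prime_line_le`);
   `differentiable_dV0primeBond_comp` (the functional depends differentiably on `A` through any continuous linear chart).
§3 `plaqWeight T w q` — the minimum of a bond weight `w` (e.g. `(Lʲη)` of `B11Eq115Space.levWeight … 1`) over the four boundary bonds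
   `(x, μ)`, `(T_μx, ν)`, `(T_νx, μ)`, `(x, ν)` of `q = p_{μν}(x)`; `plaqWeight_pos`, `le_plaqWeight`, `plaqWeight_le₁…₄`,
   **`plaqWeight_le_of_mem_st`** (`q ∈ st(b) ⇒ plaqWeight q ≦ w b`).

HONEST SCOPE — what is NOT claimed.  (i) Objects of [5]'s abstract carrier (DIVERGENCE D-pv27.4 inherited): bonds are pairs `(x, μ)`,
plaquettes triples `(x, μ, ν)` with `μ < ν`; the torus instance is the companion file's.  (ii) Hypotheses are print's and are exactly those
of `B11Eq36Complex.norm_deriv_V0prime_line_le` (unitary background `U(b)⁻¹ = U(b)*`, tracial `*`-trace, (38)/(31) trace slots with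
`κ = C₁B₃ε₁(Lʲη)⁻²`) PLUS the unit-ball bounds `‖U(b)‖, ‖U(b)⁻¹‖ ≦ 1` (print: unitary matrices in the operator norm) used for
`|δ_b X|(∂p) ≦ 4‖X‖`; nothing of (14)/(38) is derived.  (iii) `V′₀` only: the commutator group (91)–(96) (`B11Eq93Commutator`), the
composition with the Sect. C map (47) `A = A′ − HD(A′)` and the `𝔇*(A′)H*` term of (90) are NOT touched.  (iv) Constants `4`, `8`,
`4/3` are witnesses of print's «different absolute constant».  (v) Nothing of Propositions 3–9, Theorem 1 or any summit statement is
asserted; NOT summit progress (cell pub-balaban: NE9 NOT PRINTED / NOT PROVED; spine PROVED 0/9).  Unit `b2b-balaban-t4-ne9-formalise-leaf-05`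
(NE9 crux-team leaf prover, gen 64; fourth file of the lineage's (L3)/V₀-group line after `B11Eq90V0Derivative`, `B11Eq36Complex`,
`B11Eq90StB`).  Imports `B11Eq36Complex`, `B11Eq90StB` ONLY; modifies nothing of r08's.
-/

noncomputable section

open NormedSpace Complex Metric Set Finset Filter Topology

namespace Literature.MathematicalPhysics.QuantumFieldTheory.Balaban1983to89.B11Eq90V0primeBond

open Literature.MathematicalPhysics.QuantumFieldTheory.Balaban1983to89
open Literature.MathematicalPhysics.QuantumFieldTheory.Balaban1983to89.Beta.TransportVertices
open Literature.MathematicalPhysics.QuantumFieldTheory.Balaban1983to89.Beta.AdjointTransportJets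
open Literature.MathematicalPhysics.QuantumFieldTheory.Balaban1983to89.B9Eq37Insertion
open Literature.MathematicalPhysics.QuantumFieldTheory.Balaban1983to89.B9Eq39Adjoint
open Literature.MathematicalPhysics.QuantumFieldTheory.Balaban1983to89.B11Eq26ActionExpansion
open Literature.MathematicalPhysics.QuantumFieldTheory.Balaban1983to89.B11Eq90V0Derivative
open Literature.MathematicalPhysics.QuantumFieldTheory.Balaban1983to89.B11Eq90StB
open Literature.MathematicalPhysics.QuantumFieldTheory.Balaban1983to89.B11Eq36Complex

/-! ## §1 `V′₀(A, ∂p)` of (39) as a named entire function; `Cⁿ` regularity of `V₀(A, ∂p)` and `V′₀(A, ∂p)` -/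

variable {𝔸 : Type*} [NormedRing 𝔸] [NormedAlgebra ℂ 𝔸] [CompleteSpace 𝔸]

/-- `exp` is `Cⁿ` on a complete normed `ℂ`-algebra for every `n` (Mathlib: analytic) — the source of p. 282's «an analytic, and even an
entire function of A». [folklore] [cite: Balaban1985Variational, p.282] -/
theorem contDiff_expAlgebra {n : WithTop ℕ∞} : ContDiff ℂ n (fun X : 𝔸 => exp X) :=
  contDiff_iff_contDiffAt.2 fun X => (NormedSpace.exp_analytic (𝕂 := ℂ) X).contDiffAt

omit [CompleteSpace 𝔸] in
/-- The transport `X ↦ R(U₀(b))X = U₀XU₀⁻¹` is `Cⁿ`. [folklore] [cite: Balaban1985Variational, (25) p.282] -/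
theorem contDiff_R {n : WithTop ℕ∞} (V : 𝔸ˣ) : ContDiff ℂ n (fun X : 𝔸 => R V X) := by
  unfold R; fun_prop

/-- The third-order remainder `Πe^{Yᵢ} − 1 − ΣYᵢ − quad` of four `Cⁿ` letters is `Cⁿ`. [folklore] [cite: Balaban1985Variational, (34)-(35) p.283] -/
theorem contDiff_rem_four {n : WithTop ℕ∞} {E : Type*} [NormedAddCommGroup E] [NormedSpace ℂ E] {a b c d : E → 𝔸}
    (ha : ContDiff ℂ n a) (hb : ContDiff ℂ n b) (hc : ContDiff ℂ n c) (hd : ContDiff ℂ n d) :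
    ContDiff ℂ n (fun Y => rem [a Y, b Y, c Y, d Y]) := by
  have hexp := contDiff_expAlgebra (𝔸 := 𝔸) (n := n)
  simp only [rem, holonomy_cons, holonomy_nil, List.sum_cons, List.sum_nil, quad_cons, quad_nil, mul_one, add_zero]
  fun_prop

variable {S : Type*} [Fintype S] {ι : Type*} [Fintype ι] [LinearOrder ι]
variable (T : ι → Equiv.Perm S) (U : ι → S → 𝔸ˣ)

omit [LinearOrder ι] in
/-- [5]'s per-plaquette third-order remainder `ρ_p(A)` (`B9Eq39Adjoint.rem3`) is `Cⁿ` in the configuration for every `n` (p. 282: «an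
analytic, and even an entire function of A»). [cite: Balaban1985Variational, p.282] -/
theorem contDiff_rem3 {n : WithTop ℕ∞} (η : ℝ) (τ : 𝔸 →L[ℂ] ℂ) (μ ν : ι) (x : S) :
    ContDiff ℂ n (fun A : ι → S → 𝔸 => rem3 T U η (τ : 𝔸 →ₗ[ℂ] ℂ) A μ ν x) := by
  have hR1 := contDiff_R (n := n) (U ν x)
  have hR2 := contDiff_R (n := n) (U μ x)
  unfold rem3
  simp only [lettersA, letters, List.map_cons, List.map_nil, invPath_four]
  have h1 : ContDiff ℂ n (fun A : ι → S → 𝔸 =>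
      rem [(I * ↑η) • -R (U ν x) (A μ ((T ν) x)), (I * ↑η) • -A ν x, (I * ↑η) • A μ x,
        (I * ↑η) • R (U μ x) (A ν ((T μ) x))]) := by
    apply contDiff_rem_four <;> fun_prop
  have h2 : ContDiff ℂ n (fun A : ι → S → 𝔸 =>
      rem [-((I * ↑η) • R (U μ x) (A ν ((T μ) x))), -((I * ↑η) • A μ x), -((I * ↑η) • -A ν x),
        -((I * ↑η) • -R (U ν x) (A μ ((T ν) x)))]) := by
    apply contDiff_rem_four <;> fun_prop
  have hτ : ContDiff ℂ n (fun X : 𝔸 => (τ : 𝔸 →ₗ[ℂ] ℂ) X) := τ.contDiff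
  fun_prop

omit [LinearOrder ι] in
/-- **`V₀(A, ∂p)` IS `Cⁿ` IN `A` FOR EVERY `n`** (p. 282), for the tree's `B11Eq26ActionExpansion.V0p`. [cite: Balaban1985Variational, p.282, (30) p.282] -/
theorem contDiff_V0p {n : WithTop ℕ∞} (η : ℝ) (τ : 𝔸 →L[ℂ] ℂ) (μ ν : ι) (x : S) :
    ContDiff ℂ n (fun A : ι → S → 𝔸 => V0p T U η (τ : 𝔸 →ₗ[ℂ] ℂ) A μ ν x) := by
  unfold V0p
  exact contDiff_const.mul (contDiff_rem3 T U η τ μ ν x)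

/-- **The first member of (39)**: `½ i tr((DA)(p) Σ_{b₁≺b₂}[A′(b₁), A′(b₂)])` at the four transported letters of `∂p` (the expression
subtracted from `V₀(A, ∂p)` in `B11Eq36Complex.ineq40_first_complex` / `norm_deriv_V0prime_line_le`, same spelling).
[cite: Balaban1985Variational, (39) p.284] -/
def term39 (η : ℝ) (τ : 𝔸 →ₗ[ℂ] ℂ) (A : ι → S → 𝔸) (μ ν : ι) (x : S) : ℂ :=
  (2 : ℂ)⁻¹ * I * τ (curlη T U η A μ ν x
    * B11Eq34BCH.comm2 (-(R (U ν x) (A μ (T ν x)))) (-(A ν x)) (A μ x) (R (U μ x) (A ν (T μ x))))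

/-- **`V′₀(A, ∂p)`** of (39) — «where V₀′(A, ∂p) is defined by this equality»: `V₀(A, ∂p) − ½ i tr((DA)(p) Σ_{b₁≺b₂}[A′(b₁), A′(b₂)])`.
[cite: Balaban1985Variational, (39) p.284] -/
def V0primeP (η : ℝ) (τ : 𝔸 →ₗ[ℂ] ℂ) (A : ι → S → 𝔸) (μ ν : ι) (x : S) : ℂ :=
  V0p T U η τ A μ ν x - term39 T U η τ A μ ν x

omit [CompleteSpace 𝔸] [Fintype S] [Fintype ι] [LinearOrder ι] in
/-- Unfolding `V′₀(A, ∂p)` to the inline expression of `B11Eq36Complex` (§4–§5 there). [cite: Balaban1985Variational, (39) p.284] -/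
theorem V0primeP_eq (η : ℝ) (τ : 𝔸 →ₗ[ℂ] ℂ) (A : ι → S → 𝔸) (μ ν : ι) (x : S) :
    V0primeP T U η τ A μ ν x = V0p T U η τ A μ ν x - (2 : ℂ)⁻¹ * I * τ (curlη T U η A μ ν x
      * B11Eq34BCH.comm2 (-(R (U ν x) (A μ (T ν x)))) (-(A ν x)) (A μ x) (R (U μ x) (A ν (T μ x)))) := rfl

omit [CompleteSpace 𝔸] [LinearOrder ι] in
/-- The covariant curl `(DA)(p)` is `Cⁿ` (linear) in `A`. [folklore] [cite: Balaban1985Variational, (25) p.282] -/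
theorem contDiff_curlη {n : WithTop ℕ∞} (η : ℝ) (μ ν : ι) (x : S) :
    ContDiff ℂ n (fun A : ι → S → 𝔸 => curlη T U η A μ ν x) := by
  have hR1 := contDiff_R (n := n) (U ν x)
  have hR2 := contDiff_R (n := n) (U μ x)
  unfold curlη curl covD
  fun_prop

omit [CompleteSpace 𝔸] [LinearOrder ι] in
/-- The (39) term is `Cⁿ` in `A` (a cubic polynomial in the letters). [cite: Balaban1985Variational, (39) p.284] -/
theorem contDiff_term39 {n : WithTop ℕ∞} (η : ℝ) (τ : 𝔸 →L[ℂ] ℂ) (μ ν : ι) (x : S) :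
    ContDiff ℂ n (fun A : ι → S → 𝔸 => term39 T U η (τ : 𝔸 →ₗ[ℂ] ℂ) A μ ν x) := by
  have hR1 := contDiff_R (n := n) (U ν x)
  have hR2 := contDiff_R (n := n) (U μ x)
  have hτ : ContDiff ℂ n (fun X : 𝔸 => (τ : 𝔸 →ₗ[ℂ] ℂ) X) := τ.contDiff
  have hc := contDiff_curlη T U (n := n) η μ ν x (𝔸 := 𝔸)
  unfold term39 B11Eq34BCH.comm2
  simp only [Ring.lie_def]
  fun_prop

omit [LinearOrder ι] in
/-- **`V′₀(A, ∂p)` IS `Cⁿ` IN `A` FOR EVERY `n`** — in particular its Fréchet derivative is again differentiable (Prop. 4: «The functional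
derivative of V(A′) is an analytic function on this space», for this group). [cite: Balaban1985Variational, Prop. 4 p.292, p.282] -/
theorem contDiff_V0primeP {n : WithTop ℕ∞} (η : ℝ) (τ : 𝔸 →L[ℂ] ℂ) (μ ν : ι) (x : S) :
    ContDiff ℂ n (fun A : ι → S → 𝔸 => V0primeP T U η (τ : 𝔸 →ₗ[ℂ] ℂ) A μ ν x) :=
  (contDiff_V0p T U η τ μ ν x).sub (contDiff_term39 T U η τ μ ν x)

omit [LinearOrder ι] in
/-- The Fréchet derivative `A ↦ D(V′₀(·, ∂p))(A)` is differentiable. [cite: Balaban1985Variational, Prop. 4 p.292, (63) p.287] -/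
theorem differentiable_fderiv_V0primeP (η : ℝ) (τ : 𝔸 →L[ℂ] ℂ) (μ ν : ι) (x : S) :
    Differentiable ℂ (fderiv ℂ (fun A : ι → S → 𝔸 => V0primeP T U η (τ : 𝔸 →ₗ[ℂ] ℂ) A μ ν x)) :=
  ((contDiff_V0primeP T U (n := 2) η τ μ ν x).fderiv_right (m := 1) (by norm_num)).differentiable (by norm_num)

/-! ## §2 The one-bond injection and the one-bond functional `(∂/∂A(b))V′₀(A, ∂p)` of (90) -/

section Bond

variable [DecidableEq S]

omit [CompleteSpace 𝔸] in
/-- **The one-bond injection** `X ↦ δ_b X` (the configuration equal to `X` at the bond `b = (μ₀, x₀)` and `0` elsewhere) as a continuous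
linear map — the coordinate `A(b)` along which (90)'s `∂/∂A(b)` differentiates. [cite: Balaban1985Variational, (90) p.291] -/
def δL (μ₀ : ι) (x₀ : S) : 𝔸 →L[ℂ] (ι → S → 𝔸) :=
  ContinuousLinearMap.pi fun κ => ContinuousLinearMap.pi fun y =>
    if κ = μ₀ ∧ y = x₀ then ContinuousLinearMap.id ℂ 𝔸 else 0

omit [CompleteSpace 𝔸] [Fintype S] [Fintype ι] in
/-- The injection IS `B11Eq90StB.bondDelta`. [cite: Balaban1985Variational, (90) p.291] -/
theorem δL_apply (μ₀ : ι) (x₀ : S) (X : 𝔸) : δL (S := S) μ₀ x₀ X = bondDelta μ₀ x₀ X := by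
  funext κ y
  simp only [δL, ContinuousLinearMap.pi_apply, bondDelta]
  split_ifs <;> rfl

omit [NormedAlgebra ℂ 𝔸] [CompleteSpace 𝔸] [Fintype S] [Fintype ι] [LinearOrder ι] [DecidableEq S] in
/-- `‖R(V)X‖ ≦ ‖X‖` when `‖V‖, ‖V⁻¹‖ ≦ 1` (print: unitary `U₀(b)` in the operator norm). [folklore] [cite: Balaban1985Variational, (25) p.282] -/
theorem norm_R_le [NormOneClass 𝔸] {V : 𝔸ˣ} (hV : ‖(V : 𝔸)‖ ≤ 1) (hV' : ‖((V⁻¹ : 𝔸ˣ) : 𝔸)‖ ≤ 1) (X : 𝔸) :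
    ‖R V X‖ ≤ ‖X‖ := by
  rw [R_def]
  calc ‖(V : 𝔸) * X * ((V⁻¹ : 𝔸ˣ) : 𝔸)‖ ≤ ‖(V : 𝔸)‖ * ‖X‖ * ‖((V⁻¹ : 𝔸ˣ) : 𝔸)‖ :=
        (norm_mul_le _ _).trans (mul_le_mul_of_nonneg_right (norm_mul_le _ _) (norm_nonneg _))
    _ ≤ 1 * ‖X‖ * 1 := by gcongr
    _ = ‖X‖ := by ring

omit [NormedAlgebra ℂ 𝔸] [CompleteSpace 𝔸] [Fintype S] [Fintype ι] in
/-- **`|δ_b X|(∂p) ≦ 4‖X‖`**: the four transported letters of the one-bond variation have size at most `4‖X‖` (background in the unit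
balls of `𝔸` and `𝔸⁻¹`) — the `Δ` of `B11Eq90V0Derivative` / `B11Eq36Complex` for `δA = δ_b X`. [cite: Balaban1985Variational, (90) p.291, (25) p.282] -/
theorem size_lettersA_bondDelta_le [NormOneClass 𝔸]
    (hUn : ∀ μ x, ‖(U μ x : 𝔸)‖ ≤ 1 ∧ ‖(((U μ x)⁻¹ : 𝔸ˣ) : 𝔸)‖ ≤ 1) (μ₀ : ι) (x₀ : S) (X : 𝔸)
    (μ ν : ι) (x : S) : size (lettersA T U (bondDelta μ₀ x₀ X) μ ν x) ≤ 4 * ‖X‖ := by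
  have hb : ∀ κ y, ‖bondDelta (S := S) μ₀ x₀ X κ y‖ ≤ ‖X‖ := fun κ y => by
    unfold bondDelta; split_ifs <;> simp
  rw [size_lettersA]
  have h1 := (norm_R_le (hUn ν x).1 (hUn ν x).2 _).trans (hb μ (T ν x))
  have h2 := hb ν x
  have h3 := hb μ x
  have h4 := (norm_R_le (hUn μ x).1 (hUn μ x).2 _).trans (hb ν (T μ x))
  linarith

/-- **THE ONE-BOND FUNCTIONAL `X ↦ ((∂/∂A(b))V′₀)(A, ∂q)·X`** of (90) as a CONTINUOUS LINEAR MAP: the Fréchet derivative (63) of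
`V′₀(·, ∂q)` at `A` composed with the one-bond injection at `b = (μ₀, x₀)`. [cite: Balaban1985Variational, (90) p.291, (63) p.287] -/
def dV0primeBond (η : ℝ) (τ : 𝔸 →L[ℂ] ℂ) (A : ι → S → 𝔸) (q : S × ι × ι) (μ₀ : ι) (x₀ : S) :
    𝔸 →L[ℂ] ℂ :=
  (fderiv ℂ (fun B : ι → S → 𝔸 => V0primeP T U η (τ : 𝔸 →ₗ[ℂ] ℂ) B q.2.1 q.2.2 q.1) A).comp (δL μ₀ x₀)

/-- **(63)**: the one-bond functional applied to `X` IS the line derivative `(d/dt)V′₀(A + t·δ_b X, ∂q)|_{t=0}` — the quantity bounded in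
`B11Eq36Complex.norm_deriv_V0prime_line_le`. [cite: Balaban1985Variational, (63) p.287, (90) p.291] -/
theorem dV0primeBond_apply (η : ℝ) (τ : 𝔸 →L[ℂ] ℂ) (A : ι → S → 𝔸) (q : S × ι × ι) (μ₀ : ι) (x₀ : S)
    (X : 𝔸) :
    dV0primeBond T U η τ A q μ₀ x₀ X
      = deriv (fun t : ℂ => V0primeP T U η (τ : 𝔸 →ₗ[ℂ] ℂ) (A + t • bondDelta μ₀ x₀ X) q.2.1 q.2.2 q.1) 0 := by
  rw [dV0primeBond, ContinuousLinearMap.comp_apply, δL_apply,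
    deriv_line_eq_fderiv (((contDiff_V0primeP T U (n := 1) η τ q.2.1 q.2.2 q.1).differentiable (by norm_num)) A)]

omit [CompleteSpace 𝔸] [Fintype S] [Fintype ι] [LinearOrder ι] [DecidableEq S] in
/-- A plaquette whose boundary letters are blind to `δ` has the same (39)-term along the whole line `A + tδ`.
[cite: Balaban1985Variational, (39) p.284, (90) p.291] -/
theorem term39_add_smul_of_letters_zero (η : ℝ) (τ : 𝔸 →ₗ[ℂ] ℂ) {A δ : ι → S → 𝔸} {μ ν : ι} {x : S}
    (hδ : lettersA T U δ μ ν x = [0, 0, 0, 0]) (t : ℂ) :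
    term39 T U η τ (A + t • δ) μ ν x = term39 T U η τ A μ ν x := by
  simp only [lettersA, List.cons.injEq, neg_eq_zero, and_true] at hδ
  obtain ⟨h1, h2, h3, h4⟩ := hδ
  simp only [term39, curlη, curl, covD, Pi.add_apply, Pi.smul_apply, R_add, R_smul, h1, h2, h3, h4, smul_zero,
    add_zero]

omit [CompleteSpace 𝔸] [Fintype S] [Fintype ι] [LinearOrder ι] [DecidableEq S] in
/-- … hence the same `V′₀(·, ∂p)` along the line (with `B11Eq90V0Derivative.V0p_add_smul_of_letters_zero`).
[cite: Balaban1985Variational, (39) p.284, (90) p.291] -/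
theorem V0primeP_add_smul_of_letters_zero (η : ℝ) (τ : 𝔸 →ₗ[ℂ] ℂ) {A δ : ι → S → 𝔸} {μ ν : ι} {x : S}
    (hδ : lettersA T U δ μ ν x = [0, 0, 0, 0]) (t : ℂ) :
    V0primeP T U η τ (A + t • δ) μ ν x = V0primeP T U η τ A μ ν x := by
  rw [V0primeP, V0primeP, V0p_add_smul_of_letters_zero T U η τ hδ t, term39_add_smul_of_letters_zero T U η τ hδ t]

/-- **«Σ_{p∈st(b)}»: ONLY THE PLAQUETTES OF `st(b)` SEE THE BOND `b`** — the one-bond functional of a positively oriented plaquette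
outside `st(b)` is the zero map (`B11Eq90StB.lettersA_bondDelta_of_not_mem_st`). [cite: Balaban1985Variational, (90) p.291] -/
theorem dV0primeBond_eq_zero_of_not_mem_st (η : ℝ) (τ : 𝔸 →L[ℂ] ℂ) (A : ι → S → 𝔸) {q : S × ι × ι}
    (hq : q ∈ posPlaq S ι) {μ₀ : ι} {x₀ : S} (hst : q ∉ st T μ₀ x₀) : dV0primeBond T U η τ A q μ₀ x₀ = 0 := by
  ext X
  rw [dV0primeBond_apply, zero_apply]
  have hδ := lettersA_bondDelta_of_not_mem_st T U μ₀ x₀ X q hq hst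
  simp only [V0primeP_add_smul_of_letters_zero T U η (τ : 𝔸 →ₗ[ℂ] ℂ) hδ, deriv_const]

/-- **p. 291's SENTENCE IN OPERATOR NORM** — «The derivative ((∂/∂A(b))V′₀)(A, ∂p) satisfies a bound similar to the bound (40) …, but
with the power of |A| lower by 1, and with a different absolute constant»: for `|A|(∂q) ≦ s`, `0 < s`, `e^{2ηs} ≦ 2`, under the hypotheses of
`B11Eq36Complex.norm_deriv_V0prime_line_le` (unitary background, tracial `*`-trace, the (38)/(31) trace slots with constant `κ`) and a
background in the unit balls, `‖(∂/∂A(b))V′₀(A, ∂q)‖_{op} ≦ 4(8s²ηκ + (4/3)s³)` (that lemma at `δA = δ_b X`, `Δ = 4‖X‖`).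
[cite: Balaban1985Variational, (90) p.291, (40) p.284] -/
theorem opNorm_dV0primeBond_le [NormOneClass 𝔸] [StarRing 𝔸] [StarModule ℂ 𝔸]
    (hU : ∀ μ x, (((U μ x)⁻¹ : 𝔸ˣ) : 𝔸) = star (U μ x : 𝔸))
    (hUn : ∀ μ x, ‖(U μ x : 𝔸)‖ ≤ 1 ∧ ‖(((U μ x)⁻¹ : 𝔸ˣ) : 𝔸)‖ ≤ 1)
    (τ : 𝔸 →L[ℂ] ℂ) (hτ : ∀ a b : 𝔸, τ (a * b) = τ (b * a)) (hτs : ∀ a : 𝔸, τ (star a) = starRingEnd ℂ (τ a))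
    {η : ℝ} (hη : 0 < η) {κ s : ℝ} (hκ : 0 ≤ κ) (A : ι → S → 𝔸) (q : S × ι × ι) (μ₀ : ι) (x₀ : S)
    (hs : size (lettersA T U A q.2.1 q.2.2 q.1) ≤ s) (hs0 : 0 < s) (hexp : Real.exp (2 * η * s) ≤ 2)
    (hRe1 : ∀ Z : 𝔸, ‖(τ : 𝔸 →ₗ[ℂ] ℂ) (Z * (reC (plaqU T U q.2.1 q.2.2 q.1) - 1))‖ ≤ ‖Z‖ * (η ^ 2 * κ))
    (hIm : ∀ Z : 𝔸, ‖(τ : 𝔸 →ₗ[ℂ] ℂ) (Z * (((η : ℂ) ^ 2)⁻¹ • imC (plaqU T U q.2.1 q.2.2 q.1)))‖ ≤ ‖Z‖ * κ)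
    (hW : ∀ Z : 𝔸, ‖(τ : 𝔸 →ₗ[ℂ] ℂ) (Z * (plaqU T U q.2.1 q.2.2 q.1 : 𝔸))‖ ≤ ‖Z‖)
    (hW' : ∀ Z : 𝔸, ‖(τ : 𝔸 →ₗ[ℂ] ℂ) (Z * (((plaqU T U q.2.1 q.2.2 q.1)⁻¹ : 𝔸ˣ) : 𝔸))‖ ≤ ‖Z‖) :
    ‖dV0primeBond T U η τ A q μ₀ x₀‖ ≤ 4 * (8 * s ^ 2 * η * κ + 4 / 3 * s ^ 3) := by
  refine ContinuousLinearMap.opNorm_le_bound _ (by positivity) fun X => ?_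
  by_cases hX : X = 0
  · subst hX; simp
  have hΔ0 : 0 < 4 * ‖X‖ := by positivity
  rw [dV0primeBond_apply]
  have h := norm_deriv_V0prime_line_le T U hU τ hτ hτs hη hκ A (bondDelta μ₀ x₀ X) q.2.1 q.2.2 q.1 hs
    (size_lettersA_bondDelta_le T U hUn μ₀ x₀ X q.2.1 q.2.2 q.1) hs0 hΔ0 hexp hRe1 hIm hW hW'
  calc _ ≤ 4 * ‖X‖ * (8 * s ^ 2 * η * κ + 4 / 3 * s ^ 3) := h
    _ = 4 * (8 * s ^ 2 * η * κ + 4 / 3 * s ^ 3) * ‖X‖ := by ring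

/-- The one-bond functional depends differentiably on the configuration read through any continuous linear chart `g` (a `C²`
function has a `C¹` Fréchet derivative) — the carrier companion's `an₄`-clause in one line. [cite: Balaban1985Variational, Prop. 4 p.292] -/
theorem differentiable_dV0primeBond_comp {E : Type*} [NormedAddCommGroup E] [NormedSpace ℂ E]
    (g : E →L[ℂ] (ι → S → 𝔸)) (η : ℝ) (τ : 𝔸 →L[ℂ] ℂ) (q : S × ι × ι) (μ₀ : ι) (x₀ : S) :
    Differentiable ℂ (fun e : E => dV0primeBond T U η τ (g e) q μ₀ x₀) := by
  have hF : Differentiable ℂ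
      (fderiv ℂ (fun B : ι → S → 𝔸 => V0primeP T U η (τ : 𝔸 →ₗ[ℂ] ℂ) B q.2.1 q.2.2 q.1)) :=
    ((contDiff_V0primeP T U (n := 2) η τ q.2.1 q.2.2 q.1).fderiv_right (m := 1) (by norm_num)).differentiable
      (by norm_num)
  unfold dV0primeBond
  fun_prop

end Bond

/-! ## §3 The plaquette weight: the smallest of the four boundary weights -/

section Weights

omit [Fintype S] [Fintype ι] [LinearOrder ι]

/-- **The weight of a plaquette** for a bond weight `w` (print: `w(b) = (Lʲη)ⁿ`, `j` the level of the bond, `B11Eq115Space.levWeight`):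
the minimum of `w` over the four boundary bonds `(x, μ)`, `(T_μx, ν)`, `(T_νx, μ)`, `(x, ν)` of `q = p_{μν}(x)` — the scale `(Lʲη)` of the
coarsest domain `Ω_j` containing `∂q`, at which (38)/(57) are read for `q`. [cite: Balaban1985Variational, p.286, (38) p.284] -/
def plaqWeight (T : ι → Equiv.Perm S) (w : S × ι → ℝ) (q : S × ι × ι) : ℝ :=
  min (min (w (q.1, q.2.1)) (w (T q.2.1 q.1, q.2.2))) (min (w (T q.2.2 q.1, q.2.1)) (w (q.1, q.2.2)))

/-- Positive weights give a positive plaquette weight. [cite: Balaban1985Variational, p.286] -/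
theorem plaqWeight_pos {w : S × ι → ℝ} (hw : ∀ b, 0 < w b) (q : S × ι × ι) : 0 < plaqWeight T w q := by
  unfold plaqWeight; exact lt_min (lt_min (hw _) (hw _)) (lt_min (hw _) (hw _))

/-- A uniform lower bound of the weights bounds the plaquette weight from below (e.g. `η ≦ Lʲη`). [cite: Balaban1985Variational, p.286] -/
theorem le_plaqWeight {w : S × ι → ℝ} {c : ℝ} (hw : ∀ b, c ≤ w b) (q : S × ι × ι) : c ≤ plaqWeight T w q := by
  unfold plaqWeight; exact le_min (le_min (hw _) (hw _)) (le_min (hw _) (hw _))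

/-- The plaquette weight is at most the weight of the bond `(x, μ)`. [cite: Balaban1985Variational, p.286] -/
theorem plaqWeight_le₁ (w : S × ι → ℝ) (q : S × ι × ι) : plaqWeight T w q ≤ w (q.1, q.2.1) :=
  (min_le_left _ _).trans (min_le_left _ _)

/-- The plaquette weight is at most the weight of the bond `(T_μx, ν)`. [cite: Balaban1985Variational, p.286] -/
theorem plaqWeight_le₂ (w : S × ι → ℝ) (q : S × ι × ι) : plaqWeight T w q ≤ w (T q.2.1 q.1, q.2.2) :=
  (min_le_left _ _).trans (min_le_right _ _)

/-- The plaquette weight is at most the weight of the bond `(T_νx, μ)`. [cite: Balaban1985Variational, p.286] -/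
theorem plaqWeight_le₃ (w : S × ι → ℝ) (q : S × ι × ι) : plaqWeight T w q ≤ w (T q.2.2 q.1, q.2.1) :=
  (min_le_right _ _).trans (min_le_left _ _)

/-- The plaquette weight is at most the weight of the bond `(x, ν)`. [cite: Balaban1985Variational, p.286] -/
theorem plaqWeight_le₄ (w : S × ι → ℝ) (q : S × ι × ι) : plaqWeight T w q ≤ w (q.1, q.2.2) :=
  (min_le_right _ _).trans (min_le_right _ _)

variable [Fintype S] [Fintype ι] [LinearOrder ι] [DecidableEq S]

/-- **`q ∈ st(b) ⇒ plaqWeight q ≦ w(b)`**: the bond `b` is one of the four boundary bonds of every plaquette of `st(b)`.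
[cite: Balaban1985Variational, (90) p.291, p.286] -/
theorem plaqWeight_le_of_mem_st (w : S × ι → ℝ) {μ₀ : ι} {x₀ : S} {q : S × ι × ι}
    (hq : q ∈ st T μ₀ x₀) : plaqWeight T w q ≤ w (x₀, μ₀) := by
  rw [st, Finset.mem_filter] at hq
  obtain ⟨-, h⟩ := hq
  rcases h with ⟨hμ, hx | hx⟩ | ⟨hν, hx | hx⟩
  · subst hμ; subst hx; exact plaqWeight_le₃ T w q
  · subst hμ; subst hx; exact plaqWeight_le₁ T w q
  · subst hν; subst hx; exact plaqWeight_le₄ T w q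
  · subst hν; subst hx; exact plaqWeight_le₂ T w q

end Weights

end Literature.MathematicalPhysics.QuantumFieldTheory.Balaban1983to89.B11Eq90V0primeBond

end
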